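import Literature.NumberTheory.EllipticCurves.IwasawaSelmerControlAwayFromPProofs
import Literature.NumberTheory.EllipticCurves.FormalGroupKummerPointProofs
import Mathlib.NumberTheory.Padics.Complex
import Mathlib.Analysis.SpecificLimits.Basic
import HarnessLib

/-!
# `E₁(ℚ̄_p)` in Mathlib's normed field `ℚ̄_p = PadicAlgCl p`: integrality of `ℤ_p`-models,
# completeness of finite-dimensional subfields, points with coordinates in a subfield, and the
# chart estimates for the sequence `z(pᵏ P)` (cell `b2b-bsdres`, CLASS-CLOSURE lane, class O10 —
# x1b GEN 33, class lead; file 16 of the local series: groundwork for the limit logarithm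
# `Log P = lim z(pᵏP)/pᵏ` under Kobayashi's Prop. 8.11, file 17 `PadicClosureLimitLog.lean`)

HONEST FRAMING (cell `b2b-bsdres`, run/shared/lean/b2b/bsd-rank1-residual/, verbatim in every
file): the goal of the cell is to DELETE the COMBINATION-SHAPED residual classes of the
Birch–Swinnerton-Dyer formula for ALL analytic-rank `≤ 1` elliptic curves over `ℚ` — "full BSD
formula for every rank `≤ 1` curve in class `C`" assembled STRICTLY from published theorems — so
that the rank-`≤ 1` remainder becomes exactly the CONSTRUCTION-SHAPED classes, which are TYPED
(missing-input `Prop`s), NOT attempted. This is not "finishing BSD". CLASS-CLOSURE lane: prove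
what is provable now; shrink each hard class to its core with data; no claim beyond stated classes;
research routes on CONSTRUCTION-SHAPED X12 / O10; census / instrument output = EVIDENCE / conjecture
items, NEVER a Literature fact; `RESIDUAL-MAP.md` marks change only by signed lines. THIS FILE:
TOOL DEFINITION + THEOREMS (one definition with body: `subfieldPoints`; every statement proved) —
no named Literature fact, no Summits-side fact `def … : Prop`, no `sorry`, axioms standard; nothing
is booked; no label / mark / count / sub-cell moves; O10 stays OPEN / CONSTRUCTION-SHAPED; nothing
about `BSD(W, p)` of any pair is claimed.

## Why

The local side of the (C3_η) derivation rests, after x1b GEN 31/32, on `hsum` = [K] Prop. 8.12 ii)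
(generation `E(K_{n,v}) = E⁺ + E⁻`), whose proof needs the logarithm of `Ê` at points over the
ramified fields `k_n = ℚ_p(ζ_{p^{n+1}})` — injective on `Ê(m_n)`, Galois-compatible (Lemma 8.9,
Prop. 8.11). The series builds it as `Log P = lim z(pᵏP)/pᵏ` on `E₁(ℚ̄_p)` from the tree's chart
estimates over an arbitrary valued field (`FormalGroupChart`), inside Mathlib's normed field
`PadicAlgCl p = AlgebraicClosure ℚ_[p]` (spectral norm, `Valued.v = ‖·‖₊`). This file: the inputs.

## What is here (`Ω = PadicAlgCl p`, `v = Valued.v`; `V` a `v`-integral Weierstrass equation)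

* §1 `v(p) = p⁻¹ < 1`; `v ↔ ‖·‖`; `ℤ_p`-models base-changed to `Ω` are `v`-integral
  (`isIntegral_baseChange_padicInt`); **a Cauchy sequence with values in a finite-dimensional
  intermediate field `F` converges in `F`** (`exists_lim_of_cauchySeq`; Mathlib
  `Submodule.complete_of_finiteDimensional`).
* §2 `subfieldPoints V S hV` — the points of `V` with coordinates in a subfield `S ⊇ {aᵢ}` form an
  `AddSubgroup` (Mathlib's chord–tangent formulas are rational in the coordinates; Silverman
  III.2.3), `some_mem_subfieldPoints_iff`, `zCoord_mem_of_mem_subfieldPoints`.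
* §3 For ANY valued field and `P ∈ E₁`: `val_zCoord_pow_smul_le` (`|z(qᵏP)| ≤ θᵏ|z(P)|`,
  `θ = max(|q|, |z(P)|) < 1`), `val_zCoord_pow_smul_eq_of_lt` (`|z(qᵏQ)| = |q|ᵏ|z(Q)|` when
  `|z(Q)| < |q|`), `val_zCoord_pow_succ_smul_sub_le` (`|z(qᵏ⁺¹P) − q·z(qᵏP)| ≤ |z(qᵏP)|²`) — from
  the tree's `val_zCoord_nsmul` / `val_zCoord_nsmul_eq_of_lt` (Silverman IV.3.2(a), VII.2.2).

References: [SilvermanAEC2009] III.2.3, IV.1, IV.3.2, Prop. VII.2.2; [Kobayashi2003] §8.4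
(Lemma 8.9, Prop. 8.11); [NeukirchANT1999] II (4.8)–(4.9).
-/

noncomputable section

open scoped Classical NNReal Topology
open Filter

namespace Summit.BirchSwinnertonDyer.Rank1Residual.Additive

open Literature.NumberTheory.EllipticCurves Literature.NumberTheory.EllipticCurves.FormalGroupChart
  WeierstrassCurve

/-! ## §1 The absolute value of `ℚ̄_p` and completeness of finite-dimensional subfields -/

section Basics

variable {p : ℕ} [hp : Fact p.Prime]

/-- `v(p) = p⁻¹` on `ℚ̄_p`. [folklore] -/
theorem v_natCast_prime : Valued.v (p : PadicAlgCl p) = (p : ℝ≥0)⁻¹ := by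
  rw [PadicAlgCl.valuation_p, one_div]

/-- `v(p) < 1`. [folklore] -/
theorem v_prime_lt_one : Valued.v (p : PadicAlgCl p) < 1 := by
  rw [v_natCast_prime]
  exact inv_lt_one_of_one_lt₀ (by exact_mod_cast hp.out.one_lt)

/-- `v(p) ≠ 0`. [folklore] -/
theorem v_prime_ne_zero : Valued.v (p : PadicAlgCl p) ≠ 0 := by
  rw [v_natCast_prime]
  exact inv_ne_zero (by exact_mod_cast hp.out.ne_zero)

/-- `v = ‖·‖₊`: `v x ≤ r ↔ ‖x‖ ≤ r`. [folklore] -/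
theorem v_le_iff_norm_le (x : PadicAlgCl p) (r : ℝ≥0) : Valued.v x ≤ r ↔ ‖x‖ ≤ (r : ℝ) := by
  rw [PadicAlgCl.valuation_def, ← NNReal.coe_le_coe, coe_nnnorm]

/-- `v = ‖·‖₊`: `v x < r ↔ ‖x‖ < r`. [folklore] -/
theorem v_lt_iff_norm_lt (x : PadicAlgCl p) (r : ℝ≥0) : Valued.v x < r ↔ ‖x‖ < (r : ℝ) := by
  rw [PadicAlgCl.valuation_def, ← NNReal.coe_lt_coe, coe_nnnorm]

/-- `ℤ_p`-elements of `ℚ̄_p` are integral. [folklore] -/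
theorem v_algebraMap_padicInt_le_one (c : ℤ_[p]) :
    Valued.v (algebraMap ℤ_[p] (PadicAlgCl p) c) ≤ 1 := by
  rw [IsScalarTower.algebraMap_apply ℤ_[p] ℚ_[p] (PadicAlgCl p), v_le_iff_norm_le, NNReal.coe_one,
    norm_algebraMap', PadicInt.algebraMap_apply]
  exact PadicInt.norm_le_one c

/-- A Weierstrass equation over `ℤ_p`, base-changed to `ℚ̄_p`, is `v`-integral. [folklore] -/
theorem isIntegral_baseChange_padicInt (M : WeierstrassCurve ℤ_[p]) :
    (M.baseChange (PadicAlgCl p)).IsIntegral (Valued.v (R := PadicAlgCl p)).integer :=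
  isIntegral_of_exists_lift _
    ⟨⟨_, v_algebraMap_padicInt_le_one M.a₁⟩, rfl⟩ ⟨⟨_, v_algebraMap_padicInt_le_one M.a₂⟩, rfl⟩
    ⟨⟨_, v_algebraMap_padicInt_le_one M.a₃⟩, rfl⟩ ⟨⟨_, v_algebraMap_padicInt_le_one M.a₄⟩, rfl⟩
    ⟨⟨_, v_algebraMap_padicInt_le_one M.a₆⟩, rfl⟩

/-- **A Cauchy sequence of `ℚ̄_p` with values in a finite-dimensional intermediate field `F`
converges, in `F`** (finite-dimensional subspaces of a normed space over the complete field `ℚ_p`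
are complete, Mathlib `Submodule.complete_of_finiteDimensional`). Neukirch, *ANT*, II (4.8)–(4.9).
[cite: NeukirchANT1999, Ch. II Thm. (4.8)] -/
theorem exists_lim_of_cauchySeq (F : IntermediateField ℚ_[p] (PadicAlgCl p))
    [FiniteDimensional ℚ_[p] F] {a : ℕ → PadicAlgCl p} (ha : ∀ k, a k ∈ F) (hC : CauchySeq a) :
    ∃ L ∈ F, Tendsto a atTop (𝓝 L) := by
  set R : Submodule ℚ_[p] (PadicAlgCl p) := LinearMap.range F.val.toLinearMap with hR
  have hS : IsComplete (R : Set (PadicAlgCl p)) := R.complete_of_finiteDimensional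
  have haR : ∀ k, a k ∈ (R : Set (PadicAlgCl p)) := fun k => ⟨⟨a k, ha k⟩, rfl⟩
  obtain ⟨L, hLR, hL⟩ := cauchySeq_tendsto_of_isComplete hS haR hC
  obtain ⟨x, rfl⟩ := hLR
  exact ⟨_, x.2, hL⟩

end Basics

/-! ## §2 Points with coordinates in a subfield -/

section SubfieldPoints

variable {F : Type*} [Field F] (V : WeierstrassCurve F) (S : Subfield F)

/-- **The points of `V` with coordinates in a subfield `S ⊇ {a₁, …, a₆}`**: `O` and the affine points
`(x, y)` with `x, y ∈ S` — an additive subgroup, since Mathlib's chord–tangent formulas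
(`addX`, `addY`, `slope`, `negY`) are rational functions of the coordinates and the `aᵢ` (Silverman,
*AEC*, III.2.3: "the group law is given by rational functions with coefficients in `K`"; this is the
group `E(S)` inside `E(F)`). [cite: SilvermanAEC2009, III.2.3] -/
def subfieldPoints (hV : V.a₁ ∈ S ∧ V.a₂ ∈ S ∧ V.a₃ ∈ S ∧ V.a₄ ∈ S ∧ V.a₆ ∈ S) :
    AddSubgroup V.toAffine.Point where
  carrier := {P | ∀ (x y : F) (h : V.toAffine.Nonsingular x y), P = .some x y h → x ∈ S ∧ y ∈ S}
  zero_mem' := fun _ _ _ h => (WeierstrassCurve.Affine.Point.some_ne_zero _ h.symm).elim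
  neg_mem' := by
    intro P hP
    rcases P with _ | ⟨x, y, h⟩
    · intro x y h he
      rw [← WeierstrassCurve.Affine.Point.zero_def, neg_zero] at he
      exact (WeierstrassCurve.Affine.Point.some_ne_zero _ he.symm).elim
    · intro x' y' h' he
      rw [WeierstrassCurve.Affine.Point.neg_some] at he
      have hinj := (WeierstrassCurve.Affine.Point.some.injEq _ _ _ _ _ _).mp he
      obtain ⟨hx, hy⟩ := hP x y h rfl
      refine ⟨hinj.1 ▸ hx, ?_⟩
      rw [← hinj.2, WeierstrassCurve.Affine.negY]
      exact S.sub_mem (S.sub_mem (S.neg_mem hy) (S.mul_mem hV.1 hx)) hV.2.2.1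
  add_mem' := by
    intro P Q hP hQ
    rcases P with _ | ⟨x₁, y₁, h₁⟩
    · intro x y h he
      rw [← WeierstrassCurve.Affine.Point.zero_def, zero_add] at he
      exact hQ x y h he
    rcases Q with _ | ⟨x₂, y₂, h₂⟩
    · intro x y h he
      rw [← WeierstrassCurve.Affine.Point.zero_def, add_zero] at he
      exact hP x y h he
    obtain ⟨hx₁, hy₁⟩ := hP x₁ y₁ h₁ rfl
    obtain ⟨hx₂, hy₂⟩ := hQ x₂ y₂ h₂ rfl
    intro x y h he
    by_cases hxy : x₁ = x₂ ∧ y₁ = V.toAffine.negY x₂ y₂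
    · rw [WeierstrassCurve.Affine.Point.add_of_Y_eq hxy.1 hxy.2] at he
      exact (WeierstrassCurve.Affine.Point.some_ne_zero _ he.symm).elim
    · rw [WeierstrassCurve.Affine.Point.add_some hxy] at he
      obtain ⟨rfl, rfl⟩ : x = V.toAffine.addX x₁ x₂ (V.toAffine.slope x₁ x₂ y₁ y₂) ∧
          y = V.toAffine.addY x₁ x₂ y₁ (V.toAffine.slope x₁ x₂ y₁ y₂) := by
        have := (WeierstrassCurve.Affine.Point.some.injEq _ _ _ _ _ _).mp he
        exact ⟨this.1.symm, this.2.symm⟩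
      -- the slope lies in `S`
      have hL : V.toAffine.slope x₁ x₂ y₁ y₂ ∈ S := by
        by_cases hx : x₁ = x₂
        · have hy : y₁ ≠ V.toAffine.negY x₂ y₂ := fun h => hxy ⟨hx, h⟩
          rw [WeierstrassCurve.Affine.slope_of_Y_ne hx hy]
          refine S.div_mem ?_ ?_
          · exact S.sub_mem (S.add_mem (S.add_mem (S.mul_mem (ofNat_mem S 3) (S.pow_mem hx₁ 2))
              (S.mul_mem (S.mul_mem (ofNat_mem S 2) hV.2.1) hx₁)) hV.2.2.2.1) (S.mul_mem hV.1 hy₁)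
          · rw [WeierstrassCurve.Affine.negY]
            exact S.sub_mem hy₁ (S.sub_mem (S.sub_mem (S.neg_mem hy₁) (S.mul_mem hV.1 hx₁))
              hV.2.2.1)
        · rw [WeierstrassCurve.Affine.slope_of_X_ne hx]
          exact S.div_mem (S.sub_mem hy₁ hy₂) (S.sub_mem hx₁ hx₂)
      have hX : V.toAffine.addX x₁ x₂ (V.toAffine.slope x₁ x₂ y₁ y₂) ∈ S := by
        rw [WeierstrassCurve.Affine.addX]
        exact S.sub_mem (S.sub_mem (S.sub_mem (S.add_mem (S.pow_mem hL 2) (S.mul_mem hV.1 hL))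
          hV.2.1) hx₁) hx₂
      refine ⟨hX, ?_⟩
      rw [WeierstrassCurve.Affine.addY, WeierstrassCurve.Affine.negY, WeierstrassCurve.Affine.negAddY]
      exact S.sub_mem (S.sub_mem (S.neg_mem (S.add_mem (S.mul_mem hL (S.sub_mem hX hx₁)) hy₁))
        (S.mul_mem hV.1 hX)) hV.2.2.1

variable {V S}

/-- Membership in `subfieldPoints`: the affine point `(x, y)` belongs iff `x, y ∈ S`. [folklore] -/
theorem some_mem_subfieldPoints_iff (hV : V.a₁ ∈ S ∧ V.a₂ ∈ S ∧ V.a₃ ∈ S ∧ V.a₄ ∈ S ∧ V.a₆ ∈ S)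
    {x y : F} (h : V.toAffine.Nonsingular x y) :
    (.some x y h : V.toAffine.Point) ∈ subfieldPoints V S hV ↔ x ∈ S ∧ y ∈ S := by
  refine ⟨fun hP => hP x y h rfl, fun hxy => ?_⟩
  intro x' y' h' he
  obtain ⟨rfl, rfl⟩ : x' = x ∧ y' = y := by
    have := (WeierstrassCurve.Affine.Point.some.injEq _ _ _ _ _ _).mp he
    exact ⟨this.1.symm, this.2.symm⟩
  exact hxy

/-- The parameter `z = −x/y` of a point with coordinates in `S` lies in `S`. [folklore] -/
theorem zCoord_mem_of_mem_subfieldPoints (hV : V.a₁ ∈ S ∧ V.a₂ ∈ S ∧ V.a₃ ∈ S ∧ V.a₄ ∈ S ∧ V.a₆ ∈ S)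
    {P : V.toAffine.Point} (hP : P ∈ subfieldPoints V S hV) : P.zCoord ∈ S := by
  rcases P with _ | ⟨x, y, h⟩
  · rw [← WeierstrassCurve.Affine.Point.zero_def, WeierstrassCurve.Affine.Point.zCoord_zero]
    exact S.zero_mem
  · rw [WeierstrassCurve.Affine.Point.zCoord_some]
    obtain ⟨hx, hy⟩ := hP x y h rfl
    exact S.div_mem (S.neg_mem hx) hy

end SubfieldPoints

/-! ## §3 The sequence `z(pᵏ P)` on `E₁` over a valued field -/

section Seq

variable {F : Type*} [Field F] {w : Valuation F ℝ≥0} {V : WeierstrassCurve F}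
  [hV : V.IsIntegral w.integer]

/-- `pᵏ • P ∈ E₁` for `P ∈ E₁`. [cite: SilvermanAEC2009, Prop. VII.2.2] -/
theorem pow_smul_mem_kernel (q k : ℕ) {P : V.toAffine.Point} (hP : P ∈ kernel w V) :
    q ^ k • P ∈ kernel w V :=
  (kernel w V).nsmul_mem hP _

/-- **One step**: `|z(q • Q)| ≤ max(|q|, |z(Q)|) · |z(Q)|` on `E₁` (from `|z(qQ) − q z(Q)| ≤ |z(Q)|²`).
[cite: SilvermanAEC2009, Prop. IV.3.2(a), Prop. VII.2.2] -/
theorem val_zCoord_smul_le (q : ℕ) {Q : V.toAffine.Point} (hQ : Q ∈ kernel w V) :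
    w (q • Q).zCoord ≤ max (w (q : F)) (w Q.zCoord) * w Q.zCoord := by
  obtain ⟨-, -, hest⟩ := val_zCoord_nsmul (w := w) (V := V) q hQ
  have e : (q • Q).zCoord = ((q • Q).zCoord - (q : F) * Q.zCoord) + (q : F) * Q.zCoord := by ring
  rw [e]
  refine (Valuation.map_add w _ _).trans (max_le ?_ ?_)
  · exact hest.trans (by rw [sq]; exact mul_le_mul' (le_max_right _ _) le_rfl)
  · rw [map_mul]; exact mul_le_mul' (le_max_left _ _) le_rfl

/-- **Geometric decay**: with `θ = max(|q|, |z(P)|)`, `|z(qᵏ • P)| ≤ θᵏ · |z(P)|` on `E₁`.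
[cite: SilvermanAEC2009, Prop. VII.2.2] -/
theorem val_zCoord_pow_smul_le (q : ℕ) {P : V.toAffine.Point} (hP : P ∈ kernel w V) (k : ℕ) :
    w (q ^ k • P).zCoord ≤ max (w (q : F)) (w P.zCoord) ^ k * w P.zCoord := by
  induction k with
  | zero => simp
  | succ k ih =>
    have hk : q ^ k • P ∈ kernel w V := pow_smul_mem_kernel (w := w) q k hP
    rw [pow_succ, mul_comm (q ^ k) q, mul_nsmul']
    refine (val_zCoord_smul_le q hk).trans ?_
    have hmono : w (q ^ k • P).zCoord ≤ w P.zCoord :=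
      ih.trans (mul_le_of_le_one_left zero_le (pow_le_one₀ zero_le
        (max_le ((val_natCast_le_one w q)) (val_zCoord_lt_one hP).le)))
    calc max (w (q : F)) (w (q ^ k • P).zCoord) * w (q ^ k • P).zCoord
        ≤ max (w (q : F)) (w P.zCoord) * (max (w (q : F)) (w P.zCoord) ^ k * w P.zCoord) :=
          mul_le_mul' (max_le_max le_rfl hmono) ih
      _ = max (w (q : F)) (w P.zCoord) ^ (k + 1) * w P.zCoord := by ring

/-- **Exact level growth below `|q|`**: if `|z(Q)| < |q|` then `|z(qᵏ • Q)| = |q|ᵏ · |z(Q)|`.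
[cite: SilvermanAEC2009, Prop. IV.3.2(a), Prop. VII.2.2] -/
theorem val_zCoord_pow_smul_eq_of_lt (q : ℕ) {Q : V.toAffine.Point} (hQ : Q ∈ kernel w V)
    (hlt : w Q.zCoord < w (q : F)) (k : ℕ) :
    w (q ^ k • Q).zCoord = w (q : F) ^ k * w Q.zCoord := by
  induction k with
  | zero => simp
  | succ k ih =>
    have hk : q ^ k • Q ∈ kernel w V := pow_smul_mem_kernel (w := w) q k hQ
    have hlt' : w (q ^ k • Q).zCoord < w (q : F) := by
      rw [ih]
      calc w (q : F) ^ k * w Q.zCoord ≤ 1 * w Q.zCoord :=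
            mul_le_mul' (pow_le_one₀ zero_le (val_natCast_le_one w q)) le_rfl
        _ = w Q.zCoord := one_mul _
        _ < w (q : F) := hlt
    rw [pow_succ, mul_comm (q ^ k) q, mul_nsmul', val_zCoord_nsmul_eq_of_lt q hk hlt', ih]
    ring

/-- **Consecutive differences**: `|z(qᵏ⁺¹ • P) − q · z(qᵏ • P)| ≤ |z(qᵏ • P)|²`.
[cite: SilvermanAEC2009, Prop. IV.3.2(a)] -/
theorem val_zCoord_pow_succ_smul_sub_le (q : ℕ) {P : V.toAffine.Point} (hP : P ∈ kernel w V) (k : ℕ) :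
    w ((q ^ (k + 1) • P).zCoord - (q : F) * (q ^ k • P).zCoord) ≤ w (q ^ k • P).zCoord ^ 2 := by
  rw [pow_succ, mul_comm (q ^ k) q, mul_nsmul']
  exact (val_zCoord_nsmul (w := w) (V := V) q (pow_smul_mem_kernel (w := w) q k hP)).2.2

end Seq

end Summit.BirchSwinnertonDyer.Rank1Residual.Additive

end
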